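import Summits.MatrixMultiplication.OmegaCensus.DominoZ13StructSevenRows1
import HarnessLib

/-!
# Structural part-`7` route at `p = 13`: completeness rows `6`–`7` (rows file 4 of 6)

ω-census `pub-omega`, family (b3), seat pub-omega-group gen 24.  Framing: lottery ticket; floor = certified bounds/negative
ranges.  VALUE: per-prime kernel data of the STRUCTURAL part-`7` route (`DominoZpZpStructSeven*.lean`) for `p = 13` —
target: the OPEN census cell `(1,7,8)@169` (`A = ℤ₁₃²`) and every larger order with a quotient `ℤ₁₃²`; NOT progress on ω.

Rows `6`–`7` of `checkSevenRow 13 etZ13s7 tabTreeZ13s7` (`13⁴` lookups each); table, tree and the other rows in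
`DominoZ13StructSevenRows1.lean` and its siblings; independent of the other rows files.
-/

namespace Summit.MatrixMultiplication.OmegaCensus

open Finset ZpZpDomino

namespace ZpZpDomino

set_option maxHeartbeats 4000000 in
/-- Row `b = 6`, columns `0`–`4` (`5·13³` lookups). [folklore] -/
theorem checkSevenRowCols_13_6_1 : checkSevenRowCols 13 etZ13s7 tabTreeZ13s7 6 0 5 = true := by decide +kernel
set_option maxHeartbeats 4000000 in
/-- Row `b = 6`, columns `5`–`8` (`4·13³` lookups). [folklore] -/
theorem checkSevenRowCols_13_6_2 : checkSevenRowCols 13 etZ13s7 tabTreeZ13s7 6 5 4 = true := by decide +kernel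
set_option maxHeartbeats 4000000 in
/-- Row `b = 6`, columns `9`–`12` (`4·13³` lookups). [folklore] -/
theorem checkSevenRowCols_13_6_3 : checkSevenRowCols 13 etZ13s7 tabTreeZ13s7 6 9 4 = true := by decide +kernel
/-- Row `b = 6` of the completeness check, assembled from its column chunks. [folklore] -/
theorem checkSevenRow_13_6 : checkSevenRow 13 etZ13s7 tabTreeZ13s7 6 = true :=
  checkSevenRow_of_cols3 (by decide : 5 + 4 = 9) (by decide : 9 + 4 = 13) checkSevenRowCols_13_6_1 checkSevenRowCols_13_6_2 checkSevenRowCols_13_6_3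

set_option maxHeartbeats 4000000 in
/-- Row `b = 7`, columns `0`–`4` (`5·13³` lookups). [folklore] -/
theorem checkSevenRowCols_13_7_1 : checkSevenRowCols 13 etZ13s7 tabTreeZ13s7 7 0 5 = true := by decide +kernel
set_option maxHeartbeats 4000000 in
/-- Row `b = 7`, columns `5`–`8` (`4·13³` lookups). [folklore] -/
theorem checkSevenRowCols_13_7_2 : checkSevenRowCols 13 etZ13s7 tabTreeZ13s7 7 5 4 = true := by decide +kernel
set_option maxHeartbeats 4000000 in
/-- Row `b = 7`, columns `9`–`12` (`4·13³` lookups). [folklore] -/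
theorem checkSevenRowCols_13_7_3 : checkSevenRowCols 13 etZ13s7 tabTreeZ13s7 7 9 4 = true := by decide +kernel
/-- Row `b = 7` of the completeness check, assembled from its column chunks. [folklore] -/
theorem checkSevenRow_13_7 : checkSevenRow 13 etZ13s7 tabTreeZ13s7 7 = true :=
  checkSevenRow_of_cols3 (by decide : 5 + 4 = 9) (by decide : 9 + 4 = 13) checkSevenRowCols_13_7_1 checkSevenRowCols_13_7_2 checkSevenRowCols_13_7_3

end ZpZpDomino

end Summit.MatrixMultiplication.OmegaCensus
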